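import Summits.SmoothPoincare4.SmoothPoincare4.Theorems.ConvexBisectionAcyclicBisectionExistsBeltLongitudeModel
import Summits.SmoothPoincare4.SmoothPoincare4.Theorems.ConvexBisectionAcyclicBisectionExistsBeltSlideFramingVector
import HarnessLib

/-!
# The framed `r`-longitude of an attaching circle: the end framing vector modulo the velocity, and
# straight-line homotopies of framings
(node T3c-1 `node_belt_isotopic_pushoff` of the sub-goal T3 of stub `stub_steinRealisation` (NF6), line
`modp-braid-orbits`, crux `ConvexBisection.AcyclicBisectionExists`, item stmt-SmoothPoincare4-10508;
wave 3, worker Z5, lead c5; stage (3a) of V6-REPORT §2)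

* §1 the identity **`W = c θ₀ X_θ + (θ₁/c) X_{iθ} − (c θ₁/r) V`** (`frameW_eq_lincomb`, `c = √(1-r²)`) for
  the end framing vector `W = frameW` of the belt-circle slide (`helper_belt_slideFramingVector`) in the
  vocabulary of `…BeltLongitudeModel.lean`, and the transversality of the whole segment from `W` to the
  one-twist vector `X_{θ²} = θ₀ X_θ + θ₁ X_{iθ}` (`segment_frameW_twistVec_ne`);
* §2 **`framingHomotopic_of_segment`**: two framings of a knot in `∂W` that are continuous into `TW`,
  tangent to `∂W`, and whose connecting segment consists of nowhere-tangent fields, are `FramingHomotopic`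
  (the segment is the framing family);
* §3 registered helper `helper_belt_segmentFraming`.

Everything is proved; no named facts.

## References
* A. A. Kosinski, *Differential Manifolds*, Academic Press (1993), VI §6. [Kosinski1993]
* R. E. Gompf, *Handlebody construction of Stein surfaces*, Ann. of Math. 148 (1998), §1 (framings up to
  fibre homotopy). [Gompf1998]
-/

noncomputable section

-- the prescribed namespace `Summit.<P>.<Sub>.…` duplicates `SmoothPoincare4` (P = Sub)
set_option linter.dupNamespace false

open scoped Manifold ContDiff Topology RealInnerProductSpace
open Set Function Metric Real Bundle

namespace Summit.SmoothPoincare4.SmoothPoincare4.Theorems.AcyclicBisectionExists.ModpBraidOrbits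

open Literature.Topology.FourManifolds Literature.Topology.FourManifolds.HandleAttachingMap
  Literature.Geometry.Symplectic

/-! ### §1 The end framing vector modulo the velocity -/

/-- **`W = c θ₀ X_θ + (θ₁/c) X_{iθ} − (c θ₁/r) V`**: modulo the velocity the end framing of the slide is
the tube-normal framing with one twist (`0 < r < 1`, `θ₀² + θ₁² = 1`). [cite: Kosinski1993, VI §6] -/
theorem frameW_eq_lincomb {σ' r θ₀ θ₁ : ℝ} (h0 : 0 < r) (h1 : r < 1) (hθ : θ₀ ^ 2 + θ₁ ^ 2 = 1) :
    frameW σ' r θ₀ θ₁ = (Real.sqrt (1 - r ^ 2) * θ₀) • radVec σ' r θ₀ θ₁ +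
      (θ₁ / Real.sqrt (1 - r ^ 2)) • angVec θ₀ θ₁ +
      (-(Real.sqrt (1 - r ^ 2) * θ₁ / r)) • longVelVec σ' r θ₀ θ₁ := by
  set c := Real.sqrt (1 - r ^ 2) with hc
  have hc0 : 0 < c := Real.sqrt_pos.2 (by nlinarith)
  have hcsq : c ^ 2 = 1 - r ^ 2 := Real.sq_sqrt (by nlinarith)
  ext i
  fin_cases i <;> simp [frameW, radVec, angVec, longVelVec, ← hc] <;> field_simp
  · linear_combination (-(1 - r ^ 2)) * hθ + (-(θ₁ ^ 2)) * hcsq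
  · linear_combination (σ' * θ₀ * θ₁) * hcsq
  · linear_combination (1 - c ^ 2) * hθ - hcsq
  · ring

/-- **The segment from `W` to `X_{θ²}` misses the velocity line**: for `0 ≤ s ≤ 1` no
`(1-s) W + s X_{θ²}` is a multiple of `V` (`0 < r < 1`, `θ₀² + θ₁² = 1`, `σ'² = 1`). [folklore] -/
theorem segment_frameW_twistVec_ne {σ' r θ₀ θ₁ : ℝ} (hσ : σ' ^ 2 = 1) (h0 : 0 < r) (h1 : r < 1)
    (hθ : θ₀ ^ 2 + θ₁ ^ 2 = 1) {s : ℝ} (hs : s ∈ Icc (0 : ℝ) 1) (μ : ℝ) :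
    (1 - s) • frameW σ' r θ₀ θ₁ + s • twistVec σ' r θ₀ θ₁ ≠ μ • longVelVec σ' r θ₀ θ₁ := by
  set c := Real.sqrt (1 - r ^ 2) with hc
  have hc0 : 0 < c := Real.sqrt_pos.2 (by nlinarith)
  have hc1 : c ≤ 1 := by
    rw [hc, Real.sqrt_le_one]; nlinarith
  have ha : 0 < (1 - s) * c + s := by nlinarith [hs.1, hs.2]
  have hb : 0 < (1 - s) / c + s := by
    have : 0 ≤ (1 - s) / c := div_nonneg (by linarith [hs.2]) hc0.le
    rcases eq_or_lt_of_le hs.1 with h | h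
    · rw [← h]; simp [hc0]
    · linarith
  have key := lincomb_ne_smul_longVelVec hσ h0 h1 hθ ha hb ((1 - s) * (-(c * θ₁ / r))) μ
  intro heq
  apply key
  rw [← heq, frameW_eq_lincomb h0 h1 hθ, twistVec_eq_lincomb]
  simp only [← hc, smul_add, smul_smul]
  module

/-! ### §2 Straight-line homotopies of framings -/

section Segment

variable {W : Type*} [TopologicalSpace W] [ChartedSpace (EuclideanHalfSpace 4) W] [IsManifold (𝓡∂ 4) ∞ W]

/-- **Two framings of a knot in `∂W` joined by a segment of framings are homotopic**: if `ν`, `ν'` are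
continuous into `TW`, tangent to `∂W`, and no convex combination `(1-s) ν + s ν'` (`0 ≤ s ≤ 1`) is
tangent to the knot, then `FramingHomotopic K ν ν'` (the segment is the framing family).
[cite: Gompf1998, §1] -/
theorem framingHomotopic_of_segment {K : sphere (0 : EuclideanSpace ℝ (Fin 2)) 1 → W}
    (hK : IsBoundaryKnot K) {ν ν' : sphere (0 : EuclideanSpace ℝ (Fin 2)) 1 → EuclideanSpace ℝ (Fin 4)}
    (hc : Continuous fun u => (TotalSpace.mk' (EuclideanSpace ℝ (Fin 4)) (K u) (ν u) : TangentBundle (𝓡∂ 4) W))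
    (hc' : Continuous fun u => (TotalSpace.mk' (EuclideanSpace ℝ (Fin 4)) (K u) (ν' u) : TangentBundle (𝓡∂ 4) W))
    (hb : ∀ u, ν u ∈ boundaryTangentSpace) (hb' : ∀ u, ν' u ∈ boundaryTangentSpace)
    (hseg : ∀ s ∈ Icc (0 : ℝ) 1, ∀ t : ℝ,
      (1 - s) • ν (circlePt t) + s • ν' (circlePt t) ∉ (ℝ ∙ knotVelocity K t : Submodule ℝ _)) :
    FramingHomotopic K ν ν' := by
  refine ⟨hK, fun s u => (1 - s) • ν u + s • ν' u, ⟨?_, ?_, ?_⟩, ?_⟩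
  · funext u; simp
  · intro s hs
    refine ⟨?_, fun u => ?_, fun t => ?_⟩
    · exact continuous_totalSpace_lincomb hc hc' continuous_const continuous_const
    · exact Submodule.add_mem _ (Submodule.smul_mem _ _ (hb u)) (Submodule.smul_mem _ _ (hb' u))
    · simpa only [KnotIsotopyInBoundary.refl_toFun] using hseg s hs t
  · have h := continuous_totalSpace_lincomb (I := 𝓡∂ 4) (Z := ℝ × sphere (0 : EuclideanSpace ℝ (Fin 2)) 1)
      (c := fun z => K z.2) (σ₁ := fun z => ν z.2) (σ₂ := fun z => ν' z.2)
      (a := fun z => 1 - z.1) (b := fun z => z.1)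
      (hc.comp continuous_snd) (hc'.comp continuous_snd) (continuous_const.sub continuous_fst) continuous_fst
    exact h.continuousOn
  · funext u; simp

end Segment

/-! ### §3 Registered helper -/

/-- **Registered helper `helper_belt_segmentFraming` (node T3c-1 of NF6 `stub_steinRealisation`, stage
(3a), wave 3, lead c5): two framings of a knot in `∂W`, continuous into `TW` and tangent to `∂W`, whose
connecting segment `(1-s) ν + s ν'` (`0 ≤ s ≤ 1`) is nowhere tangent to the knot, are homotopic through
framings.** [cite: Gompf1998, §1] -/
theorem helper_belt_segmentFraming :
    ∀ {W : Type} [TopologicalSpace W] [ChartedSpace (EuclideanHalfSpace 4) W] [IsManifold (𝓡∂ 4) ∞ W]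
      {K : Metric.sphere (0 : EuclideanSpace ℝ (Fin 2)) 1 → W}
      {ν ν' : Metric.sphere (0 : EuclideanSpace ℝ (Fin 2)) 1 → EuclideanSpace ℝ (Fin 4)},
      Literature.Geometry.Symplectic.IsBoundaryKnot K →
      Continuous (fun u => (Bundle.TotalSpace.mk' (EuclideanSpace ℝ (Fin 4)) (K u) (ν u) : TangentBundle (𝓡∂ 4) W)) →
      Continuous (fun u => (Bundle.TotalSpace.mk' (EuclideanSpace ℝ (Fin 4)) (K u) (ν' u) : TangentBundle (𝓡∂ 4) W)) →
      (∀ u, ν u ∈ Literature.Geometry.Symplectic.boundaryTangentSpace) →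
      (∀ u, ν' u ∈ Literature.Geometry.Symplectic.boundaryTangentSpace) →
      (∀ s ∈ Set.Icc (0 : ℝ) 1, ∀ t : ℝ,
        (1 - s) • ν (Literature.Topology.FourManifolds.circlePt t) + s • ν' (Literature.Topology.FourManifolds.circlePt t) ∉
          (Submodule.span ℝ {Literature.Geometry.Symplectic.knotVelocity K t} : Submodule ℝ (EuclideanSpace ℝ (Fin 4)))) →
      Literature.Geometry.Symplectic.FramingHomotopic K ν ν' := by
  intro W _ _ _ K ν ν' hK hc hc' hb hb' hseg
  exact framingHomotopic_of_segment hK hc hc' hb hb' hseg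

end Summit.SmoothPoincare4.SmoothPoincare4.Theorems.AcyclicBisectionExists.ModpBraidOrbits

end
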